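import Summits.BirchSwinnertonDyer.Rank1Residual.Additive.X4RankZeroCyclotomicThree
import Summits.BirchSwinnertonDyer.Rank1Residual.Additive.X3RankZeroCyclotomicThreeNoLocal
import HarnessLib

/-!
# Line V14b (the X4 twin at `p = 3` over `K = ℚ(ζ₃)`, ranks `(0,0)`, UPPER half) with Milne's A73
# PROVED AWAY: `ord₃ #Ш(V) + ord₃ #Ш(W) ≤ ord₃ #Ш_an(V) + ord₃ #Ш_an(W)` for the additive twist
# `W ≅ V^{(−3)}` of a good ordinary `V` with big `3`-adic image, from the named facts Kato + Greenberg
# (+ modularity, GZK) ONLY (cell `b2b-bsdres`, team n1011, seat p16 GEN 11; lead R5-87 (e) (W2) =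
# additive-p4 GEN 23 word; row T-MIL-CAN; Facts-level consumer of `X3RankZeroCyclotomicThreeNoLocal`)

HONEST FRAMING (cell `b2b-bsdres`, run/shared/lean/b2b/bsd-rank1-residual/, verbatim in every
file): the goal of the cell is to DELETE the COMBINATION-SHAPED residual classes of the
Birch–Swinnerton-Dyer formula for ALL analytic-rank `≤ 1` elliptic curves over `ℚ` — "full BSD
formula for every rank `≤ 1` curve in class `C`" assembled STRICTLY from published theorems — so
that the rank-`≤ 1` remainder becomes exactly the CONSTRUCTION-SHAPED classes, which are TYPED
(missing-input `Prop`s), NOT attempted. This is not "finishing BSD". Team n1011 (N10 / N11), seat p16: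
research route; X3 / X4 / N10 / N11 labels and marks UNCHANGED; nothing booked. Theorems only.

This is additive-p4's `X4RankZeroCyclotomicThree.lean` (line V14b: `…_of_facts`, `…_of_surj_of_ram`,
`missingUpperBoundAt_of_surj_of_ram`, `bsdp_of_shaAn_units_of_surj_of_ram`,
`bsdp_of_casselsTate_of_pow_dvd_of_surj_of_ram`, `missingUpperBoundAt_of_twist_certificate_of_surj_of_ram`)
with the Milne binder `hMilne : Milne1972.bsdQuotient_baseChange_quadratic_anyModel` (A73) DELETED and
nothing added — every theorem is re-issued under the same name with the suffix `_noMilne`, every other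
binder and every proof line byte-identical, the core call going to the p16 twin
`X3CyclotomicThree.exists_padicVal_shaOrder_add_le_noLocal` (`X3RankZeroCyclotomicThreeNoLocal.lean`:
`Ш(V_K)` finite from `shaFinite_baseChange_of_twist`, the `3`-adic card identity from T-MIL-CAN FILE 4
`padicVal_card_identity_baseChange_of_natAbs_discr_eq` — `|d_K| = 3`, `V` good at `3`, the per-place
fibre identities (T) at EVERY place by n1011-p01's T-MIL-3 H-5a with rows T-MIL-B2 / T-A233 inside).
Remaining named facts of line V14b: Kato Thm. 17.4 (3) over `K` (`hKato`), Greenberg Thm. 4.1 over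
number fields (`hGr`), modularity (`hmod`, `hmodD`), GZK (`hGZK`) [+ Cassels–Tate `hCT` where displayed].
Label X4 UNCHANGED; nothing booked; no mark moves. References: as in `X4RankZeroCyclotomicThree`.
-/

noncomputable section

open scoped Classical MatrixGroups ModularForm

open CongruenceSubgroup WeierstrassCurve NumberField IsDedekindDomain
  Literature.NumberTheory.EllipticCurves Literature.NumberTheory.EllipticCurves.ModularForms
  Literature.NumberTheory.EllipticCurves.Rank1Residual
  Literature.NumberTheory.EllipticCurves.Rank1Residual.Typed
  Literature.NumberTheory.GaloisRepresentations

namespace Summit.BirchSwinnertonDyer.Rank1Residual.Additive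

section Facts

variable (V : WeierstrassCurve ℚ) [V.IsElliptic] [V.IsGloballyMinimal]
  (W : WeierstrassCurve ℚ) [W.IsElliptic] [W.IsGloballyMinimal]

/-- **Line V14b, core inequality, from named facts only, NO Milne** (`K = ℚ(ζ₃)` instantiated as
`CyclotomicField 3 ℚ`): for `V/ℚ` globally minimal, good ordinary at `3` with `ρ̄_{V,3^n}` surjective
for every `n`, `W = C • V^{(−3)}` globally minimal ADDITIVE at `3` (the X4 ∧ (G-ord, `e = 2`) situation
at `p = 3`), both of analytic rank `0`: `#Ш_an(V) = q_V`, `#Ш_an(W) = q_W` with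
**`ord₃ #Ш(V) + ord₃ #Ш(W) ≤ ord₃ q_V + ord₃ q_W`**, from Kato Thm. 17.4 (3) at `p = 3` over `K`
(`hKato`, named fact), Greenberg Thm. 4.1 over number fields (`hGr`, named fact; `K`-shape by
`X3CyclotomicThree.greenbergK_of_fact`), modularity (`hmod`, `hmodD`),
GZK (`hGZK`) — and NO Milne: the core is the p16 twin `X3CyclotomicThree.exists_padicVal_shaOrder_add_le_noLocal`
(`Ш(V_K)` finite and the `3`-adic card identity are THEOREMS, T-MIL-CAN FILE 4); the cyclotomic setting
and the odd-branch constant term are theorems. Binder diff vs additive-p4's `…_of_facts`: {`hMilne`} ↦ ∅.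
[cite: Kato2004Asterisque, Thm. 17.4 (3) (p. 273)] [cite: GreenbergLNM1716, Thm. 4.1 (p. 102)]
[cite: Milne1972ArithmeticAV, §1 Thm. 1 and §2 (through DokchitserDokchitserAnnals2010, §2.1, proof of Thm. 8)] -/
theorem X4CyclotomicThree.exists_padicVal_shaOrder_add_le_of_facts_noMilne
    (hKato : Kato2004.charIdeal_dvd_padicLFunction_cyclotomicThree_of_surjective)
    (hGr : Greenberg1999.thm41_charValue_rankZero_numberField)
    (hGZK : rank_eq_analyticRank_of_analyticRank_le_one) (hmod : hasEntireLFunction_rat)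
    (hmodD : nonempty_modularParametrizationData)
    (C : VariableChange ℚ) (hC : C • V.quadraticTwist (-(3 : ℚ)) = W)
    (hord : IsOrdinaryAt V 3) (hsurj : ∀ n : ℕ, V.HasSurjectiveModNGaloisRep (3 ^ n : ℕ))
    (hadd : Addv W 3) (hrV : V.analyticRank = 0) (hrW : W.analyticRank = 0) :
    ∃ qV qW : ℚ, shaAn V = (qV : ℂ) ∧ shaAn W = (qW : ℂ) ∧
      (padicValNat 3 V.shaOrder : ℤ) + padicValNat 3 W.shaOrder ≤ padicValRat 3 qV + padicValRat 3 qW := by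
  haveI : IsCyclotomicExtension {3} ℚ (CyclotomicField 3 ℚ) := CyclotomicField.isCyclotomicExtension 3 ℚ
  -- the newform and the two rational period ratios
  haveI : NeZero (V.conductorNorm ℤ) := ⟨(V.conductorNorm_pos_holds).ne'⟩
  obtain ⟨Dm⟩ := hmodD V
  have hf : IsNewformOf V Dm.f := Dm.isNewformOf
  obtain ⟨ϖ, -, hϖ, -⟩ := Dm.exists_rat_mul_realPeriodRat_eq_plusPeriod
  obtain ⟨ϖ', -, hϖ'⟩ := exists_rat_mul_imaginaryPeriodRat_eq_minusPeriod Dm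
  haveI : (V.baseChange (CyclotomicField 3 ℚ)).IsElliptic := by rw [baseChange]; infer_instance
  refine X3CyclotomicThree.exists_padicVal_shaOrder_add_le_noLocal (CyclotomicField 3 ℚ) V W hGZK hmod C
    hC hord hadd hrV hrW hf ϖ ϖ' hϖ hϖ'
    (exists_isCyclotomic_isTopGenerator_cyclotomicThree (CyclotomicField 3 ℚ))
    (fun κ γ hκ hγ hγ' D ↦ ?_)
    (X3CyclotomicThree.greenbergK_of_fact (CyclotomicField 3 ℚ) V hGr hord)
    (constantCoeff_padicLFunctionMinusBranch_one_three V hord hf)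
  exact hKato V (CyclotomicField 3 ℚ) (V.baseChange (CyclotomicField 3 ℚ)) hord hsurj
    ⟨1, one_smul _ _⟩ hκ hγ hγ' hf D ϖ ϖ' hϖ hϖ'

/-- **Line V14b with the image hypothesis as CENSUS BITS of `W`, NO Milne**: `surj(3)` (`ρ̄_{W,3}` onto) and
`ram(3)` (a multiplicative prime `ℓ ≠ 3` of `W` with `3 ∤ v_ℓ(Δ_min)`) give `ρ̄_{V,3^n}` onto for all
`n` for the twist `V` (`forall_surj_pow_of_twist_pStar_of_surj_of_ram`, gen 3), hence the core
inequality `ord₃ #Ш(V) + ord₃ #Ш(W) ≤ ord₃ #Ш_an(V) + ord₃ #Ш_an(W)` on X4 ∧ (G-ord, `e = 2`) ∧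
`p = 3` ∧ ranks `(0,0)` ∧ `surj(3) ∧ ram(3)`, from named facts only (Kato, Greenberg; NO Milne).
[cite: Kato2004Asterisque, Thm. 17.4 (3) (p. 273)] [cite: GreenbergLNM1716, Thm. 4.1 (p. 102)] -/
theorem X4CyclotomicThree.exists_padicVal_shaOrder_add_le_of_surj_of_ram_noMilne
    (hKato : Kato2004.charIdeal_dvd_padicLFunction_cyclotomicThree_of_surjective)
    (hGr : Greenberg1999.thm41_charValue_rankZero_numberField)
    (hGZK : rank_eq_analyticRank_of_analyticRank_le_one) (hmod : hasEntireLFunction_rat)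
    (hmodD : nonempty_modularParametrizationData)
    (C : VariableChange ℚ) (hC : C • V.quadraticTwist (-(3 : ℚ)) = W)
    (hord : IsOrdinaryAt V 3) (hsurj : Surj W 3) (hram : Ram W 3)
    (hadd : Addv W 3) (hrV : V.analyticRank = 0) (hrW : W.analyticRank = 0) :
    ∃ qV qW : ℚ, shaAn V = (qV : ℂ) ∧ shaAn W = (qW : ℂ) ∧
      (padicValNat 3 V.shaOrder : ℤ) + padicValNat 3 W.shaOrder ≤ padicValRat 3 qV + padicValRat 3 qW := by
  have hC' : C • V.quadraticTwist (((-((3 : ℕ) : ℤ)) : ℤ) : ℚ) = W := by push_cast; exact hC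
  exact X4CyclotomicThree.exists_padicVal_shaOrder_add_le_of_facts_noMilne V W hKato hGr hGZK hmod hmodD
    C hC hord
    (forall_surj_pow_of_twist_pStar_of_surj_of_ram 3 V (k := -1) (by norm_num) (Or.inr rfl) C hC'
      hsurj hram) hadd hrV hrW

/-- **The cell's typed UPPER half for the additive X4 curve, from named facts only, NO Milne**: in the
situation of `X4CyclotomicThree.exists_padicVal_shaOrder_add_le_of_surj_of_ram_noMilne`, if `#Ш_an(V)` has
non-positive `3`-adic valuation (`3 ∤ #Ш_an(V)`, a bit of the TWIST pair) then
`ord₃ #Ш(W) ≤ ord₃ #Ш_an(W)`, i.e. `Typed.MissingUpperBoundAt W 3`.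
[cite: Kato2004Asterisque, Thm. 17.4 (3) (p. 273)] [cite: GreenbergLNM1716, Thm. 4.1 (p. 102)] -/
theorem X4CyclotomicThree.missingUpperBoundAt_of_surj_of_ram_noMilne
    (hKato : Kato2004.charIdeal_dvd_padicLFunction_cyclotomicThree_of_surjective)
    (hGr : Greenberg1999.thm41_charValue_rankZero_numberField)
    (hGZK : rank_eq_analyticRank_of_analyticRank_le_one) (hmod : hasEntireLFunction_rat)
    (hmodD : nonempty_modularParametrizationData)
    (C : VariableChange ℚ) (hC : C • V.quadraticTwist (-(3 : ℚ)) = W)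
    (hord : IsOrdinaryAt V 3) (hsurj : Surj W 3) (hram : Ram W 3)
    (hadd : Addv W 3) (hrV : V.analyticRank = 0) (hrW : W.analyticRank = 0)
    {qV : ℚ} (hqV : shaAn V = (qV : ℂ)) (hv : padicValRat 3 qV ≤ 0) :
    MissingUpperBoundAt W 3 := by
  obtain ⟨qV', qW, hqV', hqW, hle⟩ := X4CyclotomicThree.exists_padicVal_shaOrder_add_le_of_surj_of_ram_noMilne
    V W hKato hGr hGZK hmod hmodD C hC hord hsurj hram hadd hrV hrW
  have hqq : qV' = qV := by exact_mod_cast hqV'.symm.trans hqV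
  subst hqq
  refine ⟨qW, hqW, ?_⟩
  have h0 : (0 : ℤ) ≤ padicValNat 3 V.shaOrder := by positivity
  linarith

/-- **`BSD(W,3) ∧ BSD(V,3)` on the doubly-unit X4 rows, from named facts only, NO Milne**: in the situation
of `X4CyclotomicThree.exists_padicVal_shaOrder_add_le_of_surj_of_ram_noMilne`, if `#Ш_an(V)` and `#Ш_an(W)`
are `3`-adic units then Miller's `BSD(W,3)` (the ADDITIVE X4 pair, `W[3]` irreducible, type `I₀*`)
and `BSD(V,3)` (its good ordinary big-image twist) hold. Inputs: Kato Thm. 17.4 (3), Greenberg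
Thm. 4.1 (named facts), modularity, GZK, and the census bits `surj(3)`, `ram(3)`,
`3 ∤ #Ш_an` of the two curves — nothing typed, NO Milne. Label X4 UNCHANGED; nothing booked by this theorem.
[cite: Kato2004Asterisque, Thm. 17.4 (3) (p. 273)] [cite: GreenbergLNM1716, Thm. 4.1 (p. 102)]
[cite: Milne1972ArithmeticAV, §1 Thm. 1 and §2 (through DokchitserDokchitserAnnals2010, §2.1, proof of Thm. 8)] -/
theorem X4CyclotomicThree.bsdp_of_shaAn_units_of_surj_of_ram_noMilne
    (hKato : Kato2004.charIdeal_dvd_padicLFunction_cyclotomicThree_of_surjective)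
    (hGr : Greenberg1999.thm41_charValue_rankZero_numberField)
    (hGZK : rank_eq_analyticRank_of_analyticRank_le_one) (hmod : hasEntireLFunction_rat)
    (hmodD : nonempty_modularParametrizationData)
    (C : VariableChange ℚ) (hC : C • V.quadraticTwist (-(3 : ℚ)) = W)
    (hord : IsOrdinaryAt V 3) (hsurj : Surj W 3) (hram : Ram W 3)
    (hadd : Addv W 3) (hrV : V.analyticRank = 0) (hrW : W.analyticRank = 0)
    {qV qW : ℚ} (hqV : shaAn V = (qV : ℂ)) (hqW : shaAn W = (qW : ℂ))
    (hvV : padicValRat 3 qV = 0) (hvW : padicValRat 3 qW = 0) : BSDp W 3 ∧ BSDp V 3 := by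
  obtain ⟨qV', qW', hqV', hqW', hle⟩ :=
    X4CyclotomicThree.exists_padicVal_shaOrder_add_le_of_surj_of_ram_noMilne V W hKato hGr hGZK hmod
      hmodD C hC hord hsurj hram hadd hrV hrW
  have hqq : qV' = qV := by exact_mod_cast hqV'.symm.trans hqV
  have hqq' : qW' = qW := by exact_mod_cast hqW'.symm.trans hqW
  subst hqq hqq'
  rw [hvV, hvW, add_zero] at hle
  have hV0 : (0 : ℤ) ≤ padicValNat 3 V.shaOrder := by positivity
  have hW0 : (0 : ℤ) ≤ padicValNat 3 W.shaOrder := by positivity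
  have huW : MissingUpperBoundAt W 3 := ⟨qW', hqW', by rw [hvW]; linarith⟩
  have huV : MissingUpperBoundAt V 3 := ⟨qV', hqV', by rw [hvV]; linarith⟩
  exact ⟨bsdp_of_missingPPartAt W 3 hGZK (by rw [hrW]; exact zero_le_one)
      (missingPPartAt_of_upper_of_shaAn_unit W 3 huW hqW' hvW),
    bsdp_of_missingPPartAt V 3 hGZK (by rw [hrV]; exact zero_le_one)
      (missingPPartAt_of_upper_of_shaAn_unit V 3 huV hqV' hvV)⟩

/-- **The `3 ∣ #Ш_an(W)` rows: `BSD(W,3)` from ONE finite certificate, NO Milne** (X4 ∧ (G-ord, `e = 2`) ∧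
`p = 3` ∧ ranks `(0,0)` ∧ `surj(3) ∧ ram(3)`, `3 ∤ #Ш_an(V)`). If `#Ш_an(W) = q` with `ord₃ q ≤ 2k`
and `3^{2k−1} ∣ #Ш(W)` (for `k = 1`: `Ш(W)[3] ≠ 0`, a `3`-descent certificate), then `BSD(W,3)`: the
upper half is `X4CyclotomicThree.missingUpperBoundAt_of_surj_of_ram_noMilne` (named facts only), the lower
half is Cassels–Tate squareness (`hCT` = bsd.S18, `missingLowerBoundAt_of_casselsTate_of_pow_dvd`).
Census (engine A): 3555e1, 14976k1 (`#Ш_an = 9`, `k = 1`), 19215t1 (`#Ш_an = 81`, `k = 2`).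
[cite: Kato2004Asterisque, Thm. 17.4 (3) (p. 273)] [cite: SilvermanAEC2009, Thm. X.4.14]
[cite: Miller2011LMS, §1 and Def. 1.1] -/
theorem X4CyclotomicThree.bsdp_of_casselsTate_of_pow_dvd_of_surj_of_ram_noMilne
    (hKato : Kato2004.charIdeal_dvd_padicLFunction_cyclotomicThree_of_surjective)
    (hGr : Greenberg1999.thm41_charValue_rankZero_numberField)
    (hGZK : rank_eq_analyticRank_of_analyticRank_le_one) (hmod : hasEntireLFunction_rat)
    (hmodD : nonempty_modularParametrizationData) (hCT : exists_casselsTate_pairing (K := ℚ))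
    (C : VariableChange ℚ) (hC : C • V.quadraticTwist (-(3 : ℚ)) = W)
    (hord : IsOrdinaryAt V 3) (hsurj : Surj W 3) (hram : Ram W 3)
    (hadd : Addv W 3) (hrV : V.analyticRank = 0) (hrW : W.analyticRank = 0)
    {qV : ℚ} (hqV : shaAn V = (qV : ℂ)) (hvV : padicValRat 3 qV ≤ 0)
    {q : ℚ} (hq : shaAn W = (q : ℂ)) {k : ℕ} (hv : padicValRat 3 q ≤ 2 * k)
    (hdvd : 3 ^ (2 * k - 1) ∣ W.shaOrder) : BSDp W 3 :=
  bsdp_of_missingPPartAt W 3 hGZK (by rw [hrW]; exact zero_le_one)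
    (missingPPartAt_of_lower_of_upper W 3
      (missingLowerBoundAt_of_casselsTate_of_pow_dvd W 3 hCT (hGZK W (by rw [hrW]; exact zero_le_one)).2
        hq hv hdvd)
      (X4CyclotomicThree.missingUpperBoundAt_of_surj_of_ram_noMilne V W hKato hGr hGZK hmod hmodD C hC
        hord hsurj hram hadd hrV hrW hqV hvV))

/-- **Transfer along the twist: a certificate on `V` buys the UPPER half for `W` (NO Milne).** In the situation
of `X4CyclotomicThree.exists_padicVal_shaOrder_add_le_of_surj_of_ram_noMilne`, if `#Ш_an(V) = q_V` with
`ord₃ q_V ≤ 2k` and `3^{2k−1} ∣ #Ш(V)` (a `3`-descent certificate on the TWIST; Cassels–Tate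
squareness `hCT` then gives `ord₃ q_V ≤ ord₃ #Ш(V)`), the sum inequality yields
`ord₃ #Ш(W) ≤ ord₃ #Ш_an(W)`, i.e. `Typed.MissingUpperBoundAt W 3` — the row shape of 18054p1
(`ord₃ #Ш_an(V) = 2`, `#Ш_an(W)` a unit). [cite: Kato2004Asterisque, Thm. 17.4 (3) (p. 273)]
[cite: SilvermanAEC2009, Thm. X.4.14] -/
theorem X4CyclotomicThree.missingUpperBoundAt_of_twist_certificate_of_surj_of_ram_noMilne
    (hKato : Kato2004.charIdeal_dvd_padicLFunction_cyclotomicThree_of_surjective)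
    (hGr : Greenberg1999.thm41_charValue_rankZero_numberField)
    (hGZK : rank_eq_analyticRank_of_analyticRank_le_one) (hmod : hasEntireLFunction_rat)
    (hmodD : nonempty_modularParametrizationData) (hCT : exists_casselsTate_pairing (K := ℚ))
    (C : VariableChange ℚ) (hC : C • V.quadraticTwist (-(3 : ℚ)) = W)
    (hord : IsOrdinaryAt V 3) (hsurj : Surj W 3) (hram : Ram W 3)
    (hadd : Addv W 3) (hrV : V.analyticRank = 0) (hrW : W.analyticRank = 0)
    {qV : ℚ} (hqV : shaAn V = (qV : ℂ)) {k : ℕ} (hvV : padicValRat 3 qV ≤ 2 * k)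
    (hdvdV : 3 ^ (2 * k - 1) ∣ V.shaOrder) : MissingUpperBoundAt W 3 := by
  obtain ⟨qV', qW, hqV', hqW, hle⟩ := X4CyclotomicThree.exists_padicVal_shaOrder_add_le_of_surj_of_ram_noMilne
    V W hKato hGr hGZK hmod hmodD C hC hord hsurj hram hadd hrV hrW
  have hqq : qV' = qV := by exact_mod_cast hqV'.symm.trans hqV
  subst hqq
  obtain ⟨qV'', hqV'', hlow⟩ := missingLowerBoundAt_of_casselsTate_of_pow_dvd V 3 hCT
    (hGZK V (by rw [hrV]; exact zero_le_one)).2 hqV hvV hdvdV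
  have hqq' : qV'' = qV' := by exact_mod_cast hqV''.symm.trans hqV'
  subst hqq'
  exact ⟨qW, hqW, by linarith⟩

end Facts

end Summit.BirchSwinnertonDyer.Rank1Residual.Additive

end
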